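import Literature.AlgebraicGeometry.Resolution.BlowupSNC
import Literature.AlgebraicGeometry.Resolution.MonomialMarkedIdeals
import Literature.AlgebraicGeometry.Resolution.MarkedIdealsLemmas
import Literature.AlgebraicGeometry.Resolution.RegularSequenceSpread
import Literature.AlgebraicGeometry.Resolution.SncSaturatedCentre
import Summits.ResolutionOfSingularities.ResolutionOfSingularities.Theorems.FrobeniusClosingPatchingRelPerfectDepthSNCPointwiseCongr
import HarnessLib

/-!
# (B3b) support I — SNC step algebra: strata of an snc family as centres at a point, transversal members, head replacement by
# equal germ, saturation of an ideal modulo a parameter through a surjection, and the model square of a strata step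

[OURS · L1 W4.5b · EL♮(3) stmt-ResolutionOfSingularities-20148 · desk R31 (β) DEAL «ND-K5» brick (B3b) · res-L1-w45b-stub-2 g14] — NOT a statement of the manuscript [Hironaka2017]; counted 0; AI kernel work weaker than expert review.

Generic, definition-free lemmas consumed by `…NatSNCStepCharts` and by the (B3b) brick `…NatSNCInvStepFacts` (`sncInv_stepFacts :
StepFacts O k θ P q Ch (ND.SNCInv₂ P Y)` — the candidate SNC invariant of idea-1's ND-K5 spec survives one strata step):

* `sncWithAt_finsetSup_of_sncWithAt` — if `L` has simple normal crossings AT `w` (`DepthSNC.SNCWithAt L ⊤ w`, W5.2's pointwise form of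
  the tree's `HasSNCWith`) and `S` is a finite set of members of `L`, then `L` has snc WITH the stratum `Σ_{D∈S} D` at `w` (Kollár 2007, 3.24:
  strata of an snc divisor are admissible centres); `not_stalkIdeal_le_finsetSup_of_forall_ne` — a member whose germ at `w` differs from the germs
  of the members of `S` is transversal to that stratum at `w` (minimality of a regular system of parameters, Matsumura 14.2);
  `SNCWithAt.replace_head_of_stalk_ne` — the head of the list may be replaced by any ideal sheaf with the same germ at `w` whose germ differs from
  the tail members' germs there (labels of `SNCWithAt` live on sheaves);
* `stalkIdeal_strictTransformIdeal_eq_top_of_not_mem` — the strict transform is the unit ideal over the complement of the old divisor;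
* `colon_span_pow_le_of_isRsopPart` — for `z₀, z₁, z₂` part of a regular system of parameters of `A` and a surjection `π : A ↠ B` killing `z₀` with
  `ker π ⊆ (z₀, z₁)`: `((π z₁) : (π z₂)ⁿ) ⊆ (π z₁)` (Matsumura 14.3: an r.s.p. is a regular sequence);
* `isPullback_of_model_step`, `isClosedImmersion_of_model_step`, `ker_eq_comap_ker_of_model_step` — for the closed-immersion model `jm : F → X`
  (pull-back of `Spec k → Spec O`), the new model `j' : F₂ → X₂` over `τX ≫ σ ≫ q` with `j' ≫ τX = υ ≫ jm` is the base change of `jm` along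
  `τX`; hence a closed immersion with `ker j' = (ker jm)·𝒪_{X₂}` (Mathlib `ker_fst_of_isClosedImmersion`);
* `comap_finsetSup_fun`, `stalkIdeal_finsetSup_fun`, `finsetSup_eq_top_of_mem` — finite-sup bookkeeping.

[cite: Kollar2007, Def. 3.24, Def. 3.25] [cite: Matsumura1987, Thm. 14.2, Thm. 14.3] [cite: BierstoneGrigorievMilmanWlodarczyk2011, Def. 3.1.1]
-/

set_option linter.dupNamespace false -- mandated namespace `Summit.<Summit>.<Problem>` of this single-conjunct summit

noncomputable section

open CategoryTheory CategoryTheory.Limits AlgebraicGeometry TopologicalSpace Topology IsLocalRing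
open Literature.AlgebraicGeometry.Resolution
open AlgebraicGeometry.Scheme.IdealSheafData
open Summit.ResolutionOfSingularities.ResolutionOfSingularities.Theorems.DepthSNC

namespace Summit.ResolutionOfSingularities.ResolutionOfSingularities.Cruxes.EquisingularLiftNat.Sections.ND

universe u

/-! ## `SNCWithAt` bookkeeping: strata as centres, transversal members -/

section SNC

variable {W : Scheme.{u}} {L : List W.IdealSheafData} {w : W}

/-- **A stratum of an snc family is an admissible centre at the point**: if `L` has simple normal crossings at `w` and `S` is a finite
set of members of `L`, then `L` has simple normal crossings WITH the centre `Σ_{D ∈ S} D` at `w`. [folklore; Kollár 2007, 3.24] -/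
theorem sncWithAt_finsetSup_of_sncWithAt (hL : SNCWithAt L ⊤ w) (S : Finset W.IdealSheafData) (hS : ∀ D ∈ S, D ∈ L) :
    SNCWithAt L (S.sup id) w := by
  classical
  obtain ⟨hreg, d, u, hd, hu, ⟨ι, hιinj, hι⟩, -⟩ := hL
  refine ⟨hreg, d, u, hd, hu, ⟨ι, hιinj, hι⟩, fun hx => ?_⟩
  have hxD : ∀ D ∈ S, w ∈ D.support := (mem_support_finsetSup_iff S w).mp hx
  refine ⟨{a | ∃ (D : W.IdealSheafData) (hD : D ∈ S), a = ι ⟨D, hS D hD, hxD D hD⟩}, ?_⟩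
  rw [stalkIdeal_finsetSup]
  refine le_antisymm (Finset.sup_le fun D hD => ?_) (Ideal.span_le.mpr ?_)
  · rw [hι ⟨D, hS D hD, hxD D hD⟩]
    exact Ideal.span_mono (Set.singleton_subset_iff.mpr ⟨_, ⟨D, hD, rfl⟩, rfl⟩)
  · rintro _ ⟨a, ⟨D, hD, rfl⟩, rfl⟩
    have hle : stalkIdeal D w ≤ S.sup fun K => stalkIdeal K w := Finset.le_sup (f := fun K => stalkIdeal K w) hD
    refine hle ?_
    rw [hι ⟨D, hS D hD, hxD D hD⟩]
    exact Ideal.subset_span rfl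

/-- **A member whose germ at `w` differs from the germs of the members of `S` is transversal to the stratum of `S` at `w`**: its stalk is
not contained in the stalk of `Σ_{D ∈ S} D` (minimality of a regular system of parameters). [cite: Matsumura1987, Thm. 14.2] -/
theorem not_stalkIdeal_le_finsetSup_of_forall_ne (hL : SNCWithAt L ⊤ w) {Φ : W.IdealSheafData} (hΦ : Φ ∈ L)
    (S : Finset W.IdealSheafData) (hS : ∀ D ∈ S, D ∈ L) (hne : ∀ D ∈ S, w ∈ D.support → stalkIdeal D w ≠ stalkIdeal Φ w)
    (hwS : w ∈ (S.sup id).support) (hwΦ : w ∈ Φ.support) :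
    ¬ stalkIdeal Φ w ≤ stalkIdeal (S.sup id) w := by
  classical
  intro hle
  obtain ⟨hreg, d, u, hd, hu, ⟨ι, hιinj, hι⟩, -⟩ := hL
  haveI := hreg
  have hwD : ∀ D ∈ S, w ∈ D.support := (mem_support_finsetSup_iff S w).mp hwS
  set T : Set (Fin d) := {a | ∃ (D : W.IdealSheafData) (hD : D ∈ S), a = ι ⟨D, hS D hD, hwD D hD⟩} with hT
  have hsup : stalkIdeal (S.sup id) w = Ideal.span (u '' T) := by
    rw [stalkIdeal_finsetSup]
    refine le_antisymm (Finset.sup_le fun D hD => ?_) (Ideal.span_le.mpr ?_)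
    · rw [hι ⟨D, hS D hD, hwD D hD⟩]
      exact Ideal.span_mono (Set.singleton_subset_iff.mpr ⟨_, ⟨D, hD, rfl⟩, rfl⟩)
    · rintro _ ⟨a, ⟨D, hD, rfl⟩, rfl⟩
      have hle' : stalkIdeal D w ≤ S.sup fun K => stalkIdeal K w := Finset.le_sup (f := fun K => stalkIdeal K w) hD
      refine hle' ?_
      rw [hι ⟨D, hS D hD, hwD D hD⟩]
      exact Ideal.subset_span rfl
  have hΦst := hι ⟨Φ, hΦ, hwΦ⟩
  have hmem : u (ι ⟨Φ, hΦ, hwΦ⟩) ∈ Ideal.span (u '' T) := by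
    rw [← hsup]
    exact hle (hΦst ▸ Ideal.mem_span_singleton_self _)
  have hnot : ι ⟨Φ, hΦ, hwΦ⟩ ∉ T := by
    rintro ⟨D, hD, hDeq⟩
    have hlab : (⟨Φ, hΦ, hwΦ⟩ : {K // K ∈ L ∧ w ∈ K.support}) = ⟨D, hS D hD, hwD D hD⟩ := hιinj hDeq
    have hΦD : Φ = D := congrArg Subtype.val hlab
    exact hne D hD (hwD D hD) (by rw [hΦD])
  exact not_mem_span_image_of_not_mem hd u hu hnot hmem

/-- **Replacing the head member by an ideal sheaf with the same stalk at `w`**, the new head's germ being different from the germs of the tail members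
through `w` (so that labels stay injective). [cite: BierstoneGrigorievMilmanWlodarczyk2011, Def. 3.1.1] -/
theorem SNCWithAt.replace_head_of_stalk_ne {A A' C : W.IdealSheafData} {L : List W.IdealSheafData} (h : SNCWithAt (A :: L) C w)
    (hst : stalkIdeal A' w = stalkIdeal A w) (hne : ∀ D ∈ L, w ∈ D.support → w ∈ A'.support → stalkIdeal D w ≠ stalkIdeal A' w) :
    SNCWithAt (A' :: L) C w := by
  classical
  have hsuppA : w ∈ A'.support ↔ w ∈ A.support := mem_support_iff_of_stalkIdeal_eq hst
  refine h.of_stalk_eq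
    (fun D' => if hD : D'.1 = A' then ⟨A, List.mem_cons_self, hsuppA.mp (hD ▸ D'.2.2)⟩
      else ⟨D'.1, List.mem_cons_of_mem _ ((List.mem_cons.mp D'.2.1).resolve_left hD), D'.2.2⟩) ?_ ?_
  · intro D₁ D₂ h12
    by_cases h1 : D₁.1 = A' <;> by_cases h2 : D₂.1 = A'
    · exact Subtype.ext (h1.trans h2.symm)
    · exfalso
      simp only [h1, h2, dif_pos, dif_neg, not_false_eq_true, Subtype.mk.injEq] at h12
      have hD₂L : D₂.1 ∈ L := (List.mem_cons.mp D₂.2.1).resolve_left h2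
      exact hne D₂.1 hD₂L D₂.2.2 (h1 ▸ D₁.2.2) (by rw [← h12, ← hst])
    · exfalso
      simp only [h1, h2, dif_pos, dif_neg, not_false_eq_true, Subtype.mk.injEq] at h12
      have hD₁L : D₁.1 ∈ L := (List.mem_cons.mp D₁.2.1).resolve_left h1
      exact hne D₁.1 hD₁L D₁.2.2 (h2 ▸ D₂.2.2) (by rw [h12, ← hst])
    · simp only [h1, h2, dif_neg, not_false_eq_true, Subtype.mk.injEq] at h12
      exact Subtype.ext h12
  · intro D'
    by_cases hD : D'.1 = A'
    · simp only [hD, dif_pos]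
      rw [← hst]
    · simp only [hD, dif_neg, not_false_eq_true]

end SNC

/-! ## Stalks of strict transforms off the divisor -/

section StrictTransformStalks

variable {X X' : Scheme.{u}} [IsLocallyNoetherian X'] (π : X' ⟶ X) (C : X.IdealSheafData)

/-- Off the old divisor the strict transform is the unit ideal: `(π♯ K)_{x'} = ⊤` when `π x' ∉ V(K)`. [folklore; GW (13.19)] -/
theorem stalkIdeal_strictTransformIdeal_eq_top_of_not_mem (K : X.IdealSheafData) {x' : X'}
    (hx : π x' ∉ K.support) : stalkIdeal (strictTransformIdeal π C K) x' = ⊤ := by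
  rw [stalkIdeal_strictTransformIdeal π C K x', stalkIdeal_eq_top_of_not_mem_support hx, Ideal.map_top]
  refine top_le_iff.mp (le_trans ?_ (le_iSup _ 0))
  intro y _
  exact Submodule.mem_colon.mpr fun a _ => Submodule.mem_top

end StrictTransformStalks

/-! ## Saturation through a surjection with kernel a parameter -/

section Saturation

variable {A B : Type*} [CommRing A] [CommRing B] [IsLocalRing A]

/-- **Colon ideals modulo a parameter.** Let `z₀, z₁, z₂` be part of a regular system of parameters of `A` and `π : A ↠ B` a
surjection killing `z₀` with `ker π ⊆ (z₀, z₁)`. Then `((π z₁) : (π z₂)ⁿ) = (π z₁)` in `B` — `z₂` is a non-zero-divisor modulo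
`(z₀, z₁)` (Matsumura 14.2/14.3: a regular system of parameters is a regular sequence in any order). [cite: Matsumura1987, Thm. 14.3] -/
theorem colon_span_pow_le_of_isRsopPart (π : A →+* B) (hπ : Function.Surjective π) {z : Fin 3 → A} (hz : IsRsopPart z)
    (h0 : π (z 0) = 0) (hker : RingHom.ker π ≤ Ideal.span {z 0, z 1}) (n : ℕ) :
    Submodule.colon (Ideal.span {π (z 1)}) ((Ideal.span {π (z 2)} ^ n : Ideal B) : Set B) ≤ Ideal.span {π (z 1)} := by
  intro b hb
  obtain ⟨a, rfl⟩ := hπ b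
  have hIio : z '' Set.Iio (2 : Fin 3) = {z 0, z 1} := by
    ext c
    simp only [Set.mem_image, Set.mem_Iio, Set.mem_insert_iff, Set.mem_singleton_iff]
    constructor
    · rintro ⟨i, hi, rfl⟩
      have : i = 0 ∨ i = 1 := by
        rcases Fin.lt_def.mp hi with h
        have h' : (i : ℕ) < 2 := h
        omega
      rcases this with rfl | rfl
      · exact Or.inl rfl
      · exact Or.inr rfl
    · rintro (rfl | rfl)
      · exact ⟨0, by decide, rfl⟩
      · exact ⟨1, by decide, rfl⟩
  -- `a · z₂ⁿ ∈ (z₀, z₁)`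
  have hmem : π (a * z 2 ^ n) ∈ Ideal.span {π (z 1)} := by
    rw [map_mul, map_pow]
    exact Submodule.mem_colon.mp hb _ (Ideal.pow_mem_pow (Ideal.mem_span_singleton_self _) n)
  have hJ : a * z 2 ^ n ∈ Ideal.span {z 0, z 1} := by
    have h1 : a * z 2 ^ n ∈ (Ideal.span {π (z 1)}).comap π := Ideal.mem_comap.mpr hmem
    have h2 : Ideal.span {π (z 1)} = (Ideal.span {z 1}).map π := by
      rw [Ideal.map_span, Set.image_singleton]
    rw [h2, Ideal.comap_map_of_surjective π hπ] at h1
    rcases Submodule.mem_sup.mp h1 with ⟨c, hc, d, hd, hcd⟩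
    rw [← hcd]
    refine Ideal.add_mem _ (Ideal.span_mono (by simp) hc) (hker ?_)
    exact hd
  -- peel off the powers of `z₂`
  have hpeel : ∀ m : ℕ, ∀ c : A, c * z 2 ^ m ∈ Ideal.span {z 0, z 1} → c ∈ Ideal.span {z 0, z 1} := by
    intro m
    induction m with
    | zero => intro c hc; simpa using hc
    | succ m ih =>
      intro c hc
      apply ih
      have h' : z 2 * (c * z 2 ^ m) ∈ Ideal.span (z '' Set.Iio (2 : Fin 3)) := by
        rw [hIio, show z 2 * (c * z 2 ^ m) = c * z 2 ^ (m + 1) by ring]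
        exact hc
      have := hz.mem_of_mul_mem 2 _ h'
      rwa [hIio] at this
  have ha : a ∈ Ideal.span {z 0, z 1} := hpeel n a hJ
  -- push down
  have : π a ∈ (Ideal.span {z 0, z 1}).map π := Ideal.mem_map_of_mem _ ha
  rw [Ideal.map_span, Set.image_insert_eq, Set.image_singleton, h0] at this
  simpa [Ideal.span_insert, Ideal.span_singleton_zero] using this

end Saturation

/-! ## The model square of a strata step -/

section ModelSquare

variable {X X₂ F F₂ S B : Scheme.{u}} {jm : F ⟶ X} {t : F ⟶ B} {r : X ⟶ S} {b : B ⟶ S}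
  {τX : X₂ ⟶ X} {j' : F₂ ⟶ X₂} {t' : F₂ ⟶ B} {υ : F₂ ⟶ F}

/-- **The new model square is the base change of the old one along the blow-up**: if `jm : F → X` is a closed immersion and a
pullback of `b` along `r`, `j' : F₂ → X₂` a pullback of `b` along `τX ≫ r`, and `j' ≫ τX = υ ≫ jm`, then `(j', υ; τX, jm)` is a
pullback square (pasting; `jm` is a monomorphism). [folklore] -/
theorem isPullback_of_model_step [IsClosedImmersion jm] (hsq : IsPullback jm t r b)
    (hsq' : IsPullback j' t' (τX ≫ r) b) (hcomm : j' ≫ τX = υ ≫ jm) : IsPullback j' υ τX jm := by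
  have hw : (j' ≫ τX) ≫ r = t' ≫ b := by rw [Category.assoc]; exact hsq'.w
  set υ' := hsq.lift (j' ≫ τX) t' hw with hυ'
  have h1 : υ' ≫ jm = j' ≫ τX := hsq.lift_fst _ _ hw
  have h2 : υ' ≫ t = t' := hsq.lift_snd _ _ hw
  have hυ : υ' = υ := by
    rw [← cancel_mono jm, h1, hcomm]
  have hs : IsPullback j' (υ' ≫ t) (τX ≫ r) b := by rw [h2]; exact hsq'
  have h := IsPullback.of_bot hs h1.symm hsq
  rwa [hυ] at h

/-- The new model is a closed immersion. [folklore] -/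
theorem isClosedImmersion_of_model_step [IsClosedImmersion jm] (h : IsPullback j' υ τX jm) : IsClosedImmersion j' :=
  MorphismProperty.IsStableUnderBaseChange.of_isPullback h.flip inferInstance

/-- **The kernel of the new model is the total transform of the kernel of the old one**: `ker j' = (ker jm)·𝒪_{X₂}`.
[folklore] -/
theorem ker_eq_comap_ker_of_model_step [IsClosedImmersion jm] (h : IsPullback j' υ τX jm) : j'.ker = jm.ker.comap τX := by
  have hj : j' = h.isoPullback.hom ≫ pullback.fst τX jm := (h.isoPullback_hom_fst).symm
  rw [hj, Scheme.Hom.ker_comp_of_isIso, Scheme.IdealSheafData.ker_fst_of_isClosedImmersion]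

end ModelSquare

/-! ## Finite-sup bookkeeping -/

section FinsetSup

/-- `f^*` commutes with finite sups indexed by any finset. [folklore] -/
theorem comap_finsetSup_fun {ι : Type*} {X Y : Scheme.{u}} (g : Y ⟶ X) (s : Finset ι) (f : ι → X.IdealSheafData) :
    (s.sup f).comap g = s.sup fun i => (f i).comap g := by
  classical
  induction s using Finset.induction_on with
  | empty => simp [(Scheme.IdealSheafData.map_gc g).l_bot]
  | insert a s has ih => rw [Finset.sup_insert, Finset.sup_insert, (Scheme.IdealSheafData.map_gc g).l_sup, ih]

/-- Stalks commute with finite sups indexed by any finset. [folklore] -/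
theorem stalkIdeal_finsetSup_fun {ι : Type*} {X : Scheme.{u}} (s : Finset ι) (f : ι → X.IdealSheafData) (x : X) :
    stalkIdeal (s.sup f) x = s.sup fun i => stalkIdeal (f i) x := by
  classical
  induction s using Finset.induction_on with
  | empty => simp [stalkIdeal_bot]
  | insert a s has ih => rw [Finset.sup_insert, Finset.sup_insert, stalkIdeal_sup, ih]

/-- A finite sup containing a `⊤` term is `⊤`. [folklore] -/
theorem finsetSup_eq_top_of_mem {ι α : Type*} [SemilatticeSup α] [OrderBot α] [OrderTop α] {s : Finset ι} {f : ι → α} {i : ι}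
    (hi : i ∈ s) (h : f i = ⊤) : s.sup f = ⊤ :=
  le_antisymm le_top (le_trans (le_of_eq h.symm) (Finset.le_sup (f := f) hi))

end FinsetSup

end Summit.ResolutionOfSingularities.ResolutionOfSingularities.Cruxes.EquisingularLiftNat.Sections.ND

end
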